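import Literature.Topology.FourManifolds.BoundaryGluingRelHomology
import Literature.Topology.FourManifolds.BoundaryManifoldHomologyVanishing
import Literature.AlgebraicTopology.SingularHomology.EulerCharacteristicTriple
import Literature.AlgebraicTopology.SingularHomology.WuClasses
import Literature.AlgebraicTopology.SingularHomology.ModPBettiNumbers
import Mathlib.LinearAlgebra.Dimension.Localization
import HarnessLib

/-!
# Euler characteristic of a boundary gluing: `χ(A ∪_φ B) = χ(A) + χ(B) - χ(∂A)`
(sub-goal `stub_modelsOn_counts_eulerGluing` of stub `stub_modelsOn_counts`, line `modp-braid-orbits`,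
reshape r9, crux `ConvexBisection.AcyclicBisectionExists`, item stmt-SmoothPoincare4-10508)

The first clause `l.length = 4 * g` of the named fact
`LefschetzBase.modelsOn_counts_of_homotopyEquiv_sphere` (Gompf–Stipsicz 1999, §8.2) is an Euler
characteristic count over the one-sided model `M = X ∪_Ψ Base g` of a homotopy 4-sphere:
`2 = χ(M) = χ(X) + χ(Base g) - χ(∂ Base g)`.  This file PROVES the gluing half of that count for the
tree's relational boundary gluings `IsBoundaryGluing bA bB φ (𝓡 (m+2)) M` (`Gluing.lean`) of two
compact smooth manifolds with boundary, in every dimension `m + 2 ≥ 2`, with arbitrary Noetherian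
coefficients of the tree's Euler characteristic `relEuler R Gr · ∅` (`EulerCharacteristicTriple.lean`,
Mathlib's `GradedObject.eulerChar` of the graded module `k ↦ Hₖ(·; Gr)`):

* `finRelHomology_and_relEuler_of_isBoundaryGluing` — **`χ(M) = χ(A) + χ(B) - χ(∂A)`** together with
  the finiteness of `H_•(M; Gr)` (Hatcher 2002, §2.2 Thm. 2.44: `χ` is additive along the exact
  sequences of the triples `∅ ⊆ jA(A) ⊆ M` and `∅ ⊆ ∂B ⊆ B`, the tree's `FinRelHomology.triple_mid` /
  `triple_right`; and `Hₖ(B, ∂B) ≅ Hₖ(M, jA A)`, the tree's excision for gluings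
  `BoundaryGluingData.isIso_map_jB_boundary'`, Hatcher Thm. 2.20 / Prop. 2.22; the degenerate gluing
  along an empty boundary is the disjoint union, handled by plain excision of the clopen piece);
* `relEuler_eq_zero_of_odd` — **`χ(Y) = 0` for a closed topological manifold of odd dimension**
  (Hatcher 2002, Cor. 3.37: over `𝔽₂` every closed manifold is oriented and `bₖ = b_{n-k}`, the tree's
  `bettiNumber_eq_bettiNumber_of_add_eq_holds` with `modTwoOrientation`; and `χ` may be computed with
  `𝔽₂` coefficients, the tree's `eulerChar_int_eq_eulerChar_zmod`);
* the four-dimensional reading `relEuler_of_isBoundaryGluing_four`: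
  **`χ(M) = χ(A) + χ(B)`** for a boundary gluing of compact smooth 4-manifolds with boundary (the seam is a
  closed 3-manifold), and the registered sub-goal `stub_modelsOn_counts_eulerGluing`.

Everything is proved from tree theorems; no definitions, no named facts, no `sorry`.
-/

noncomputable section

-- the prescribed namespace `Summit.<P>.<Sub>.…` duplicates `SmoothPoincare4` (P = Sub)
set_option linter.dupNamespace false

open scoped Manifold ContDiff Topology ContinuousMap
open Set Function CategoryTheory CategoryTheory.Limits
open Literature.AlgebraicTopology.SingularHomology Literature.Topology.FourManifolds

universe v

namespace Summit.SmoothPoincare4.SmoothPoincare4.Theorems.AcyclicBisectionExists.ModpBraidOrbits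

/-! ## Finiteness data of compact manifolds, arbitrary Noetherian coefficients -/

section Finiteness

variable (R : Type v) [CommRing R] [IsNoetherianRing R] (Gr : Type v) [AddCommGroup Gr] [Module R Gr]
  [Module.Finite R Gr]

/-- **A closed topological `n`-manifold has finitely generated homology, zero above degree `n`**, for
finitely generated coefficients over a Noetherian ring (Hatcher 2002, App. A Cor. A.8–A.9 and
Thm. 3.26(c); the tree's `finite_singularHomology_of_compact_chartedSpace`,
`isZero_singularHomology_of_lt_holds`). [folklore] -/
theorem finRelHomology_of_closedManifold {n : ℕ} (Y : Type) [TopologicalSpace Y] [CompactSpace Y]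
    [T2Space Y] [ChartedSpace (EuclideanSpace ℝ (Fin n)) Y] : FinRelHomology R Gr Y ∅ (n + 1) :=
  FinRelHomology.empty_of_absolute
    (fun k => finite_singularHomology_of_compact_chartedSpace R Gr (d := n) k)
    (fun k hk => isZero_singularHomology_of_lt_holds R Gr Y n (by omega))

/-- **A compact smooth `(n+1)`-manifold with boundary has finitely generated homology, zero above degree
`n + 1`**, for finitely generated coefficients over a Noetherian ring (Hatcher 2002, App. A Cor. A.8–A.9;
Thm. 3.26(c) for the double; the tree's `finite_singularHomology_of_compact_chartedSpace_halfSpace`,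
`isZero_singularHomology_of_dim_lt`). [folklore] -/
theorem finRelHomology_of_compact_halfSpace {n : ℕ} (W : Type) [TopologicalSpace W] [T2Space W]
    [CompactSpace W] [ChartedSpace (EuclideanHalfSpace (n + 1)) W] [IsManifold (𝓡∂ (n + 1)) ∞ W] :
    FinRelHomology R Gr W ∅ (n + 2) :=
  FinRelHomology.empty_of_absolute
    (fun k => finite_singularHomology_of_compact_chartedSpace_halfSpace R Gr (n := n) k)
    fun k hk => isZero_singularHomology_of_dim_lt (n := n) W R Gr (by omega)

end Finiteness

/-! ## `χ = 0` for closed manifolds of odd dimension -/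

section Odd

/-- **The Euler characteristic of a closed topological manifold of odd dimension vanishes**
(Hatcher 2002, Cor. 3.37 and its proof remark): computed with `𝔽₂` coefficients
(`eulerChar_int_eq_eulerChar_zmod`, Hatcher §3.A Ex. 1) the alternating sum `Σₖ (-1)ᵏ bₖ` of the mod-2
Betti numbers is reversed in sign by the symmetry `bₖ = b_{n-k}` of the `𝔽₂`-oriented closed manifold
(`bettiNumber_eq_bettiNumber_of_add_eq_holds`, `modTwoOrientation`), `n` being odd. [folklore] -/
theorem relEuler_eq_zero_of_odd {n : ℕ} (hn : Odd n) (Y : Type) [TopologicalSpace Y] [CompactSpace Y]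
    [T2Space Y] [ChartedSpace (EuclideanSpace ℝ (Fin n)) Y] : relEuler ℤ ℤ Y ∅ = 0 := by
  have hF := finRelHomology_of_closedManifold ℤ ℤ (n := n) Y
  rw [hF.relEuler_empty_eq_sum, eulerChar_int_eq_eulerChar_zmod (p := 2) n Y]
  -- the mod-2 Betti numbers and their symmetry
  set b : ℕ → ℤ := fun k => (Module.finrank (ZMod 2) (singularHomology (ZMod 2) (ZMod 2) Y k) : ℤ)
    with hb
  have hsymm : ∀ k, k ≤ n → b (n - k) = b k := fun k hk => by
    simp only [hb]
    exact_mod_cast bettiNumber_eq_bettiNumber_of_add_eq_holds (ZMod 2) Y n ⟨modTwoOrientation Y n⟩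
      (show (n - k) + k = n by omega)
  have hsign : ∀ k, k ≤ n → (-1 : ℤ) ^ (n - k) = -(-1) ^ k := fun k hk => by
    have h1 : (-1 : ℤ) ^ (n - k) * (-1) ^ k = -1 := by
      rw [← pow_add, Nat.sub_add_cancel hk, hn.neg_one_pow]
    have h2 : ((-1 : ℤ) ^ k) * (-1) ^ k = 1 := by
      rw [← pow_add, ← two_mul, pow_mul, neg_one_sq, one_pow]
    calc (-1 : ℤ) ^ (n - k) = (-1) ^ (n - k) * (-1) ^ k * (-1) ^ k := by rw [mul_assoc, h2, mul_one]
      _ = -(-1) ^ k := by rw [h1, neg_one_mul]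
  -- reflect the sum
  have hrefl := Finset.sum_range_reflect (fun k => (-1 : ℤ) ^ k * b k) (n + 1)
  have hS : ∑ k ∈ Finset.range (n + 1), (-1 : ℤ) ^ k * b k =
      -∑ k ∈ Finset.range (n + 1), (-1 : ℤ) ^ k * b k := by
    conv_lhs => rw [← hrefl]
    rw [← Finset.sum_neg_distrib]
    refine Finset.sum_congr rfl fun k hk => ?_
    have hk' : k ≤ n := Nat.lt_succ_iff.mp (Finset.mem_range.mp hk)
    simp only [show n + 1 - 1 - k = n - k by omega]
    rw [hsymm k hk', hsign k hk', neg_mul]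
  change ∑ k ∈ Finset.range (n + 1), (-1 : ℤ) ^ k * b k = 0
  linarith

end Odd

/-! ## `χ(A ∪_φ B) = χ(A) + χ(B) - χ(∂A)` -/

section Gluing

variable (R : Type v) [CommRing R] [IsNoetherianRing R] [HasRankNullity.{v} R]
  (Gr : Type v) [AddCommGroup Gr] [Module R Gr] [Module.Finite R Gr]

variable {m : ℕ}
  {A : Type} [TopologicalSpace A] [T2Space A] [SecondCountableTopology A] [CompactSpace A]
  [ChartedSpace (EuclideanHalfSpace (m + 1 + 1)) A] [IsManifold (𝓡∂ (m + 1 + 1)) ∞ A]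
  {B : Type} [TopologicalSpace B] [T2Space B] [SecondCountableTopology B] [CompactSpace B]
  [ChartedSpace (EuclideanHalfSpace (m + 1 + 1)) B] [IsManifold (𝓡∂ (m + 1 + 1)) ∞ B]
  {M : Type} [TopologicalSpace M] [ChartedSpace (EuclideanSpace ℝ (Fin (m + 1 + 1))) M]
  [IsManifold (𝓡 (m + 1 + 1)) ∞ M]

/-- **`Hₖ(B, ∂B) ≅ Hₖ(M, jA A)` in Euler-characteristic form**, for gluing data of `M = A ∪_φ B`:
`H_•(M, jA A; Gr)` is finitely generated, vanishes from degree `m + 4` on, and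
`χ(M, jA A) = χ(B, ∂B) = χ(B) - χ(∂B)` (Hatcher 2002, Thm. 2.20 / Prop. 2.22 in the tree's form
`BoundaryGluingData.isIso_map_jB_boundary'` when `∂B ≠ ∅`; when `∂B = ∅` the pieces are complementary
clopen sets and plain excision of `jA A` applies; then Thm. 2.44 for the triple `∅ ⊆ ∂B ⊆ B`).
[folklore] -/
theorem finRelHomology_and_relEuler_range_jA (bA : BoundaryData (𝓡∂ (m + 1 + 1)) A (𝓡 (m + 1)))
    (bB : BoundaryData (𝓡∂ (m + 1 + 1)) B (𝓡 (m + 1)))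
    (φ : bA.carrier ≃ₘ⟮𝓡 (m + 1), 𝓡 (m + 1)⟯ bB.carrier)
    (G : BoundaryGluingData bA bB φ.toEquiv M) :
    FinRelHomology R Gr M (range G.jA) (m + 4) ∧
      relEuler R Gr M (range G.jA) = relEuler R Gr B ∅ - relEuler R Gr bB.carrier ∅ := by
  haveI : Nontrivial R := nontrivial_of_hasRankNullity.{v} R
  haveI : CompactSpace bB.carrier := bB.compactSpace_carrier
  haveI : T2Space bB.carrier := bB.isSmoothEmbedding.isEmbedding.t2Space
  -- (1) the triple `∅ ⊆ ∂B ⊆ B`: `χ(B) = χ(∂B) + χ(B, ∂B)`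
  set dB : Set B := (𝓡∂ (m + 1 + 1)).boundary B with hdB
  let eB : bB.carrier ≃ₜ ↥dB :=
    bB.isSmoothEmbedding.isEmbedding.toHomeomorph.trans (Homeomorph.setCongr bB.range_incl)
  have hSB : FinRelHomology R Gr (↥dB) (Subtype.val ⁻¹' (∅ : Set B)) (m + 3) := by
    rw [preimage_empty]
    exact ((finRelHomology_of_closedManifold R Gr (n := m + 1) bB.carrier).of_homeomorph eB
      (mapsTo_empty _ _) (mapsTo_empty _ _)).mono (by omega)
  have hSBe : relEuler R Gr (↥dB) (Subtype.val ⁻¹' (∅ : Set B)) = relEuler R Gr bB.carrier ∅ := by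
    rw [preimage_empty]
    exact (relEuler_eq_of_homeomorph eB (mapsTo_empty _ _) (mapsTo_empty _ _)).symm
  have hB0 : FinRelHomology R Gr B ∅ (m + 3) :=
    finRelHomology_of_compact_halfSpace R Gr (n := m + 1) B
  obtain ⟨hBd, hBde⟩ := FinRelHomology.triple_right (R := R) (M := Gr) (empty_subset dB) hSB hB0
  rw [hSBe] at hBde
  -- (2) `H_•(M, jA A) ≅ H_•(B, ∂B)`
  suffices h : FinRelHomology R Gr M (range G.jA) (m + 4) ∧
      relEuler R Gr M (range G.jA) = relEuler R Gr B dB by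
    exact ⟨h.1, by rw [h.2]; linarith⟩
  rcases isEmpty_or_nonempty bB.carrier with hE | hN
  · -- empty seam: `range jA` is clopen, excise it
    have hdBempty : dB = ∅ := by
      rw [hdB, ← bB.range_incl]
      exact range_eq_empty _
    have hdisj : Disjoint (range G.jA) (range G.jB) := by
      rw [Set.disjoint_left]
      rintro _ ⟨a, rfl⟩ ⟨b, hb⟩
      obtain ⟨z, -, -⟩ := (G.jA_eq_jB_iff a b).mp hb.symm
      exact hE.elim (φ z)
    have hcompl : (range G.jA)ᶜ = range G.jB := by
      refine Set.Subset.antisymm (fun x hx => ?_) fun x hx hx' => Set.disjoint_left.mp hdisj hx' hx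
      have hx' : x ∈ range G.jA ∪ range G.jB := G.range_union ▸ Set.mem_univ x
      exact hx'.resolve_left hx
    have hopen : IsOpen (range G.jA) := by
      rw [← compl_compl (range G.jA), hcompl]
      exact G.isClosed_range_jB.isOpen_compl
    have hexc := relativeSingularHomology.isIso_map_of_closure_subset_interior_holds R Gr M
      (A := range G.jA) (U := range G.jA)
      (by rw [G.isClosed_range_jA.closure_eq, hopen.interior_eq])
    -- the complement of `jA A` is a copy of `B`
    let e : B ≃ₜ ↥((range G.jA)ᶜ) :=
      G.isSmoothEmbedding_jB.isEmbedding.toHomeomorph.trans (Homeomorph.setCongr hcompl.symm)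
    have hpre : (Subtype.val ⁻¹' range G.jA : Set ↥((range G.jA)ᶜ)) = ∅ :=
      Set.eq_empty_of_forall_notMem fun x hx => x.2 hx
    have he : MapsTo e dB (Subtype.val ⁻¹' range G.jA) := by
      rw [hdBempty]; exact mapsTo_empty _ _
    have he' : MapsTo e.symm (Subtype.val ⁻¹' range G.jA) dB := by
      rw [hpre]; exact mapsTo_empty _ _
    have hC : FinRelHomology R Gr (↥((range G.jA)ᶜ)) (Subtype.val ⁻¹' range G.jA) (m + 4) :=
      hBd.of_homeomorph e he he'
    have hCe : relEuler R Gr (↥((range G.jA)ᶜ)) (Subtype.val ⁻¹' range G.jA) = relEuler R Gr B dB :=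
      (relEuler_eq_of_homeomorph e he he').symm
    let ex : ∀ k, relativeSingularHomology R Gr (↥((range G.jA)ᶜ)) (Subtype.val ⁻¹' range G.jA) k ≅
        relativeSingularHomology R Gr M (range G.jA) k := fun k =>
      @asIso _ _ _ _ (relativeSingularHomology.map R Gr (X := ↥((range G.jA)ᶜ))
        (subsetIncl ((range G.jA)ᶜ))
        (mapsTo_preimage Subtype.val (range G.jA) :
          MapsTo _ (Subtype.val ⁻¹' range G.jA) (range G.jA)) k) (hexc k)
    exact ⟨hC.of_iso ex, (relEuler_eq_of_iso ex).symm.trans hCe⟩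
  · -- nonempty seam: the tree's excision for gluings, on the null-cobordisms of the seams
    let cA : NullCobordism (m + 1) bA.carrier :=
      { W := A
        incl := bA.incl
        isSmoothEmbedding_incl := bA.isSmoothEmbedding
        range_incl := bA.range_incl }
    let cB : NullCobordism (m + 1) bB.carrier :=
      { W := B
        incl := bB.incl
        isSmoothEmbedding_incl := bB.isSmoothEmbedding
        range_incl := bB.range_incl }
    let G' : BoundaryGluingData cA.boundaryData cB.boundaryData φ.toEquiv M :=
      { jA := G.jA
        jB := G.jB
        isSmoothEmbedding_jA := G.isSmoothEmbedding_jA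
        isSmoothEmbedding_jB := G.isSmoothEmbedding_jB
        range_union := G.range_union
        jA_eq_jB_iff := G.jA_eq_jB_iff }
    let ex : ∀ k, relativeSingularHomology R Gr B dB k ≅ relativeSingularHomology R Gr M (range G.jA) k :=
      fun k =>
      haveI := G'.isIso_map_jB_boundary' R Gr k
      asIso (relativeSingularHomology.map R Gr (⟨G'.jB, G'.continuous_jB⟩ : C(cB.W, M))
        G'.mapsTo_jB_boundary k)
    exact ⟨hBd.of_iso ex, (relEuler_eq_of_iso ex).symm⟩

/-- **Euler characteristic of a boundary gluing: `χ(A ∪_φ B) = χ(A) + χ(B) - χ(∂A)`**, with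
finiteness.  For compact smooth `(m+2)`-manifolds with boundary `A`, `B`, boundary data `bA`, `bB`, a
diffeomorphism `φ : ∂A ≅ ∂B` and ANY smooth `M` which is the gluing `A ∪_φ B`
(`IsBoundaryGluing bA bB φ (𝓡 (m+2)) M`), the homology `H_•(M; Gr)` (finitely generated coefficients
`Gr` over a Noetherian ring `R` with rank–nullity, e.g. `ℤ` or a field) is finitely generated, vanishes
from degree `m + 4` on, and `χ(M) = χ(A) + χ(B) - χ(bA.carrier)` for the tree's `relEuler R Gr · ∅`
(Hatcher 2002, Thm. 2.44 along the triples `∅ ⊆ jA A ⊆ M`, `∅ ⊆ ∂B ⊆ B` — the tree's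
`FinRelHomology.triple_mid/right` — and excision `Hₖ(B, ∂B) ≅ Hₖ(M, jA A)` for the gluing, Hatcher
Thm. 2.20 / Prop. 2.22, the tree's `BoundaryGluingData.isIso_map_jB_boundary'`).  The Mayer–Vietoris
count of Gompf–Stipsicz 1999, §1.2 / Kirby 1989, II §1. [folklore] -/
theorem finRelHomology_and_relEuler_of_isBoundaryGluing
    (bA : BoundaryData (𝓡∂ (m + 1 + 1)) A (𝓡 (m + 1))) (bB : BoundaryData (𝓡∂ (m + 1 + 1)) B (𝓡 (m + 1)))
    (φ : bA.carrier ≃ₘ⟮𝓡 (m + 1), 𝓡 (m + 1)⟯ bB.carrier) (h : IsBoundaryGluing bA bB φ (𝓡 (m + 1 + 1)) M) :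
    FinRelHomology R Gr M ∅ (m + 4) ∧
      relEuler R Gr M ∅ = relEuler R Gr A ∅ + relEuler R Gr B ∅ - relEuler R Gr bA.carrier ∅ := by
  haveI : Nontrivial R := nontrivial_of_hasRankNullity.{v} R
  obtain ⟨G⟩ := h.nonempty_boundaryGluingData'
  obtain ⟨hMA, hMAe⟩ := finRelHomology_and_relEuler_range_jA R Gr bA bB φ G
  -- `χ(∂B) = χ(∂A)`
  have hseam : relEuler R Gr bB.carrier ∅ = relEuler R Gr bA.carrier ∅ :=
    (relEuler_eq_of_homeomorph φ.toHomeomorph (mapsTo_empty _ _) (mapsTo_empty _ _)).symm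
  -- the triple `∅ ⊆ jA A ⊆ M`
  let eA : A ≃ₜ ↥(range G.jA) := G.isSmoothEmbedding_jA.isEmbedding.toHomeomorph
  have hAj : FinRelHomology R Gr (↥(range G.jA)) (Subtype.val ⁻¹' (∅ : Set M)) (m + 4) := by
    rw [preimage_empty]
    exact ((finRelHomology_of_compact_halfSpace R Gr (n := m + 1) A).of_homeomorph eA
      (mapsTo_empty _ _) (mapsTo_empty _ _)).mono (by omega)
  have hAje : relEuler R Gr (↥(range G.jA)) (Subtype.val ⁻¹' (∅ : Set M)) = relEuler R Gr A ∅ := by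
    rw [preimage_empty]
    exact (relEuler_eq_of_homeomorph eA (mapsTo_empty _ _) (mapsTo_empty _ _)).symm
  obtain ⟨hM, hMe⟩ := FinRelHomology.triple_mid (R := R) (M := Gr) (empty_subset (range G.jA)) hAj hMA
  refine ⟨hM, ?_⟩
  rw [hMe, hAje, hMAe, hseam]
  ring

end Gluing

/-! ## Dimension four -/

section Four

variable {A : Type} [TopologicalSpace A] [T2Space A] [SecondCountableTopology A] [CompactSpace A]
  [ChartedSpace (EuclideanHalfSpace 4) A] [IsManifold (𝓡∂ 4) ∞ A]
  {B : Type} [TopologicalSpace B] [T2Space B] [SecondCountableTopology B] [CompactSpace B]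
  [ChartedSpace (EuclideanHalfSpace 4) B] [IsManifold (𝓡∂ 4) ∞ B]
  {M : Type} [TopologicalSpace M] [ChartedSpace (EuclideanSpace ℝ (Fin 4)) M] [IsManifold (𝓡 4) ∞ M]

/-- **`χ(A ∪_φ B) = χ(A) + χ(B) - χ(∂A)` for compact smooth 4-manifolds with boundary**, arbitrary
Noetherian coefficients with rank–nullity (the case `m = 2` of
`finRelHomology_and_relEuler_of_isBoundaryGluing`, with the instances re-read at `2 + 1 + 1`).
[folklore] -/
theorem finRelHomology_and_relEuler_of_isBoundaryGluing_four
    (R : Type v) [CommRing R] [IsNoetherianRing R] [HasRankNullity.{v} R]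
    (Gr : Type v) [AddCommGroup Gr] [Module R Gr] [Module.Finite R Gr]
    (bA : BoundaryData (𝓡∂ 4) A (𝓡 3)) (bB : BoundaryData (𝓡∂ 4) B (𝓡 3))
    (φ : bA.carrier ≃ₘ⟮𝓡 3, 𝓡 3⟯ bB.carrier) (h : IsBoundaryGluing bA bB φ (𝓡 4) M) :
    FinRelHomology R Gr M ∅ 6 ∧
      relEuler R Gr M ∅ = relEuler R Gr A ∅ + relEuler R Gr B ∅ - relEuler R Gr bA.carrier ∅ := by
  -- bridging instances at `2 + 1 + 1` / `2 + 1`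
  letI iA1 : ChartedSpace (EuclideanHalfSpace (2 + 1 + 1)) A := ‹ChartedSpace (EuclideanHalfSpace 4) A›
  letI iA2 : IsManifold (𝓡∂ (2 + 1 + 1)) ∞ A := ‹IsManifold (𝓡∂ 4) ∞ A›
  letI iB1 : ChartedSpace (EuclideanHalfSpace (2 + 1 + 1)) B := ‹ChartedSpace (EuclideanHalfSpace 4) B›
  letI iB2 : IsManifold (𝓡∂ (2 + 1 + 1)) ∞ B := ‹IsManifold (𝓡∂ 4) ∞ B›
  letI iM1 : ChartedSpace (EuclideanSpace ℝ (Fin (2 + 1 + 1))) M :=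
    ‹ChartedSpace (EuclideanSpace ℝ (Fin 4)) M›
  letI iM2 : IsManifold (𝓡 (2 + 1 + 1)) ∞ M := ‹IsManifold (𝓡 4) ∞ M›
  letI ia3 : ChartedSpace (EuclideanSpace ℝ (Fin (2 + 1))) bA.carrier := bA.chartedSpace
  letI ia4 : IsManifold (𝓡 (2 + 1)) ∞ bA.carrier := bA.isManifold
  letI ib3 : ChartedSpace (EuclideanSpace ℝ (Fin (2 + 1))) bB.carrier := bB.chartedSpace
  letI ib4 : IsManifold (𝓡 (2 + 1)) ∞ bB.carrier := bB.isManifold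
  exact finRelHomology_and_relEuler_of_isBoundaryGluing R Gr (m := 2) bA bB φ h

/-- **`χ(A ∪_φ B) = χ(A) + χ(B)` for a boundary gluing of compact smooth 4-manifolds with boundary**,
integer coefficients: the seam `∂A` is a closed 3-manifold, so `χ(∂A) = 0` (`relEuler_eq_zero_of_odd`).
This is the count "`χ(M) = χ(X) + χ(Base g) - χ(∂ Base g)`, `χ(∂ Base g) = 0`" of the first clause of
`LefschetzBase.modelsOn_counts_of_homotopyEquiv_sphere` (Gompf–Stipsicz 1999, §8.2). [folklore] -/
theorem relEuler_of_isBoundaryGluing_four (bA : BoundaryData (𝓡∂ 4) A (𝓡 3))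
    (bB : BoundaryData (𝓡∂ 4) B (𝓡 3)) (φ : bA.carrier ≃ₘ⟮𝓡 3, 𝓡 3⟯ bB.carrier)
    (h : IsBoundaryGluing bA bB φ (𝓡 4) M) :
    FinRelHomology ℤ ℤ M ∅ 6 ∧ relEuler ℤ ℤ M ∅ = relEuler ℤ ℤ A ∅ + relEuler ℤ ℤ B ∅ := by
  haveI : CompactSpace bA.carrier := bA.compactSpace_carrier
  haveI : T2Space bA.carrier := bA.isSmoothEmbedding.isEmbedding.t2Space
  obtain ⟨hM, hMe⟩ := finRelHomology_and_relEuler_of_isBoundaryGluing_four ℤ ℤ bA bB φ h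
  refine ⟨hM, ?_⟩
  rw [hMe, relEuler_eq_zero_of_odd (n := 3) (by decide) bA.carrier, sub_zero]

end Four

/-! ## The registered sub-goal -/

section SubGoal

/-- **Sub-goal `stub_modelsOn_counts_eulerGluing` of stub `stub_modelsOn_counts`** (line
`modp-braid-orbits`, r9; the Euler-characteristic bookkeeping of the first clause `l.length = 4 * g`
of `LefschetzBase.modelsOn_counts_of_homotopyEquiv_sphere`, Gompf–Stipsicz 1999 §8.2): for ANY
boundary gluing `M = A ∪_φ B` of compact smooth 4-manifolds with boundary along a diffeomorphism of
boundary data, the integral homology of `M` is finitely generated and bounded, and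
`χ(M) = χ(A) + χ(B) - χ(∂A)` with `χ(∂A) = 0`. [folklore] -/
theorem stub_modelsOn_counts_eulerGluing :
    ∀ (M : Type) [TopologicalSpace M] [ChartedSpace (EuclideanSpace ℝ (Fin 4)) M] [IsManifold (𝓡 4) ∞ M]
      (A : Type) [TopologicalSpace A] [T2Space A] [SecondCountableTopology A] [CompactSpace A]
      [ChartedSpace (EuclideanHalfSpace 4) A] [IsManifold (𝓡∂ 4) ∞ A]
      (B : Type) [TopologicalSpace B] [T2Space B] [SecondCountableTopology B] [CompactSpace B]
      [ChartedSpace (EuclideanHalfSpace 4) B] [IsManifold (𝓡∂ 4) ∞ B]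
      (bA : BoundaryData (𝓡∂ 4) A (𝓡 3)) (bB : BoundaryData (𝓡∂ 4) B (𝓡 3))
      (φ : bA.carrier ≃ₘ⟮𝓡 3, 𝓡 3⟯ bB.carrier),
      IsBoundaryGluing bA bB φ (𝓡 4) M →
      FinRelHomology ℤ ℤ M ∅ 6 ∧ relEuler ℤ ℤ bA.carrier ∅ = 0 ∧
        relEuler ℤ ℤ M ∅ = relEuler ℤ ℤ A ∅ + relEuler ℤ ℤ B ∅ - relEuler ℤ ℤ bA.carrier ∅ := by
  intro M _ _ _ A _ _ _ _ _ _ B _ _ _ _ _ _ bA bB φ h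
  haveI : CompactSpace bA.carrier := bA.compactSpace_carrier
  haveI : T2Space bA.carrier := bA.isSmoothEmbedding.isEmbedding.t2Space
  obtain ⟨hM, hMe⟩ := finRelHomology_and_relEuler_of_isBoundaryGluing_four ℤ ℤ bA bB φ h
  exact ⟨hM, relEuler_eq_zero_of_odd (n := 3) (by decide) bA.carrier, hMe⟩

end SubGoal

end Summit.SmoothPoincare4.SmoothPoincare4.Theorems.AcyclicBisectionExists.ModpBraidOrbits

end
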